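import Summits.QuantumFields.YangMills.Theorems.BalabanUVNodesN07DentRowsTwoBlocks
import Summits.QuantumFields.YangMills.Theorems.BalabanUVNodesN07ShearedFrameLetters
import Summits.QuantumFields.YangMills.Theorems.BalabanUVNodesN07NormalisationSymOfRecord
import Summits.QuantumFields.YangMills.Theorems.BalabanUVNodesK0UniformFluxConfig
import HarnessLib

/-!
# N07 [B11] (= [15] = [Balaban1985Variational]) Sect. F — plan g93 WORD A3⁵ = ρ3 ∕ director №311 (B′), chart side (III): **THE WITHIN-BLOCK LETTER IN THE AVERAGED-CONTOUR AXIAL GAUGE**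
# ([I] (0.11)) — the `symCd` twin of MODULE 71 §1 `dist1_le_of_axialGauge_radial_box`: if the level-`m` field `W` is block-axial for the averaged contour datum `symContourData federbushSU`
# and every level-`m` plaquette based in the box of the block `B(castSite t)` is within `a` of `1`, then every bond with both ends in the block satisfies
# `dist1 (W b) ≤ (14·d·⌊(L−1)∕2⌋ + 1)·((d−1)(L−1)·a)` — the representative-side input of the DENT near rows 97′ (with MODULE 70's convention-free two-block Lemma 1 for the crossing bonds)

Cell `pub-ymgap`, seat `pub-ymgap-dag-n07-e` g30 (FAN-OUT §N07 row s3; LANE OWNER of the K0 road chart side).  `--kind proof --supports stmt-QuantumFields-20541 --as helper` (K0⁷);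
count-neutral; THEOREMS ONLY (0 `def`); §1 generic `P`, `N ≥ 1`.  [15] = [Balaban1985Variational]; [6] = [Balaban1985RegularSpaces]; [I] = [Balaban1987RG1]; [3] = [Balaban1985Averaging].

WHY.  Under ρ3 the representative `U″ = U^{h̄w}` of the premise of record has its averages `M^m(U″)` axial for the AVERAGED contour datum of [I] (0.11) (`NrmSymOfRecord`: `w` residual with
`symCd`-axial tower), not for the one-path radial datum; the dent near rows (print's (160) second case, [6] Lemma 1 on `Λ′ = B(x) ∪ B(x′)`) need the within-block letter for THAT gauge.
The proof is MODULE 71 §1's: pv26's box gauge `G` on the block (every box bond `(d−1)(L−1)a`-close: `dist1_gaugeAct_axialGauge_le_of_mem_boxBonds`), `g := G(centre)⁻¹·G`; in the gauge `g`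
every centre staircase is a product of at most `d·⌊(L−1)∕2⌋` box bonds, so within `σ′ := d⌊(L−1)∕2⌋·τ`; the axiality `M({W(Γ^σ_{y,x})}_σ) = 1` and Federbush's two-sided equivariance (0.6)
give `g(x)⁻¹ = M({(W^g)(Γ^σ_{y,x})}_σ)`, within `7σ′` of `1` (✓`…N07ShearedFrameLetters.norm_coe_fedM_sub_one_le`); finally `W b = g(b₋)⁻¹·(W^g b)·g(b₊)`.

WHAT IS PROVED (sorry-free; axioms standard).
* §1 ★★ `dist1_le_of_axialGauge_sym_box` (generic `P`, `SU(N)`): the within-block letter above, guards `L < N_m` and `2σ′ < δ_F` (Federbush's radius).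
* §2 AT THE RECORD ★ `dist1_iter_within_le_of_box_sym` — `F`-level reading for `M^m U′` with the `symCd F N K m`-axial tower (71 §2's `dist1_iter_within_le_of_box` twin), and
  ★★ `dist1_iter_crossing_le_of_twoBlocks_sym` — the crossing bonds of a dent pair at such a representative: MODULE 70's convention-free two-block Lemma 1
  `dist1_crossingBond_iter_le_of_succ_twoBlocks` with §2's within-block letter on both blocks (71 §2's `dist1_iter_crossing_le_of_twoBlocks` twin).
HONEST SCOPE: elementary holonomy bookkeeping ([6] pp. 79–80's argument with Federbush's mean in place of the radial path); nothing of [15]∕[6]∕[3] analysis asserted beyond MODULES 70 ∕ pv26;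
97′∕98′∕99′ NOT here; K0⁷ NOT closed; N07 NOT discharged; counts unmoved; one finite 𝕋⁴ programme at fixed ε — the route closes the conditional finite-𝕋⁴ rung `BalabanLadder.UV` ONLY; the YM
mass gap (Clay) is NOT proved by any of this; nothing continuum ∕ ℝ⁴ ∕ OS.  No `def`, no `instance`, no `notation`, no `sorry`.

References: [6] (1.15) p. 78, Lemma 1 (1.25) p. 79, pp. 79–80; [I] (0.3)–(0.11) pp. 252–253; [15] (160) p. 303; [3] (11) p. 19.
-/

set_option autoImplicit false

noncomputable section

open scoped BigOperators Matrix.Norms.L2Operator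

namespace Summit.QuantumFields.YangMills.BalabanUVNodes.N07SymGaugeWithinBlock

open Literature.MathematicalPhysics.QuantumFieldTheory.Balaban1983to89
open Literature.MathematicalPhysics.QuantumFieldTheory.Balaban1983to89.Node00
open T4Continuum (T4Family stairWord walk holAt)
open T4AxialGaugeSmallField (castSite castSite_apply castSite_add_e boxBonds boxPlaqs axialGauge dist1_gaugeAct_axialGauge_le_of_mem_boxBonds)
open B7Prop1Explicit (e e_apply)
open B14DomainGeom (Pt)
open GaugeField (gaugeAct)
open ExpMeanLog (expMeanLogSU deltaSU)
open FederbushMean (federbushSU deltaFed federbushSU_δ dist1_SU_eq)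
open BlockAveraging (off off_bounds)
open B10Eq27TorusAxialLog (holT holT_eq_holAt)
open Summit.QuantumFields.YangMills.Theorems.K0UniformFluxConfig (dist1_holAt_le_length_mul)
open Summit.QuantumFields.YangMills.BalabanUVNodes.N07SymContourData (permEnum stairFamily symContourData symContourData_holTo_of_small stairFamily_gaugeAct
  familySmall_stairFamily_gaugeAct_iff)
open Summit.QuantumFields.YangMills.BalabanUVNodes.N07NormalisationSymOfRecord (symCd)
open Summit.QuantumFields.YangMills.BalabanUVNodes.N07ShearedFrameLetters (familySmall_of_norm_le norm_coe_fedM_sub_one_le)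
open Summit.QuantumFields.YangMills.BalabanUVNodes.N07ShearSizeTopBox (mem_boxBonds_of_ends_mem_box)
open Summit.QuantumFields.YangMills.BalabanUVNodes.N07AveragedPlaquetteCornerBlocks (mem_blowDown_of_blockOf_mem_box)
open Summit.QuantumFields.YangMills.BalabanUVNodes.N07Lemma1CrossingBondsTwoBlocks (dist1_crossingBond_iter_le_of_succ_twoBlocks)
open Summit.QuantumFields.YangMills.BalabanUVNodes.N07DataDownTheTower (exists_coarse_of_crossing)
open Summit.QuantumFields.YangMills.BalabanUVNodes.N07DentRowsTwoBlocks (boxPlaqs_mono)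

/-! ## §1  The within-block letter in the averaged-contour axial gauge -/

section Sym

variable {P : Params} {N : ℕ} [NeZero N] {m : ℕ}

/-- ★★ **THE WITHIN-BLOCK LETTER IN THE AVERAGED-CONTOUR AXIAL GAUGE** ([I] (0.11); [6] pp. 79–80 with Federbush's mean in place of the radial path): if `W` is block-axial for
`symContourData federbushSU` and every level-`m` plaquette based in the box `[L·t, L·t + (L−1)]` of `B(castSite t)` is within `a` of `1` (`0 ≤ a`, `L < N_m`, and the stair guard
`2·(d⌊(L−1)∕2⌋·((d−1)(L−1)a)) < δ_F`), then every bond with both ends in the block satisfies `dist1 (W b) ≤ (14·d·⌊(L−1)∕2⌋ + 1)·((d−1)(L−1)·a)`.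
[cite: Balaban1985RegularSpaces, (1.15) p.78, pp.79–80 (proof of Lemma 1); Balaban1987RG1, (0.6) p.253, (0.11) p.253] -/
theorem dist1_le_of_axialGauge_sym_box (hm : m + 1 ≤ P.m + P.K) (W : GaugeField P m (SU N))
    (hW : AxialGauge (symContourData (federbushSU (n := Fin N))) W) {a : ℝ} (ha : 0 ≤ a) (hN : P.L < P.sitesPerDir m) (t : Fin P.d → ℤ)
    (hplaq : PlaqSmallOn (boxPlaqs (fun i => (P.L : ℤ) * t i) (fun i => (P.L : ℤ) * t i + ((P.L : ℤ) - 1))) a W)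
    (hguard : 2 * (((P.d * ((P.L - 1) / 2) : ℕ) : ℝ) * ((((P.d - 1 : ℕ) : ℝ) * ((P.L - 1 : ℕ) : ℝ)) * a)) < (federbushSU (n := Fin N)).δ)
    (b : PBond P m) (hsrc : blockOf b.src = (castSite t : Site P (m + 1))) (htgt : blockOf b.tgt = (castSite t : Site P (m + 1))) :
    dist1 (W b) ≤ ((14 * (P.d * ((P.L - 1) / 2)) + 1 : ℕ) : ℝ) * ((((P.d - 1 : ℕ) : ℝ) * ((P.L - 1 : ℕ) : ℝ)) * a) := by
  classical
  set lo : Fin P.d → ℤ := fun i => (P.L : ℤ) * t i with hlo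
  set hi : Fin P.d → ℤ := fun i => (P.L : ℤ) * t i + ((P.L : ℤ) - 1) with hhi
  set y : Site P (m + 1) := castSite t with hy
  set Gy : GaugeTransf P m (SU N) := axialGauge W lo hi with hGy
  set g : GaugeTransf P m (SU N) := fun x => (Gy (emb y))⁻¹ * Gy x with hg
  set τ : ℝ := ((P.d - 1 : ℕ) : ℝ) * ((P.L - 1 : ℕ) : ℝ) * a with hτdef
  set σ' : ℝ := ((P.d * ((P.L - 1) / 2) : ℕ) : ℝ) * τ with hσ'def
  have hτ : 0 ≤ τ := by positivity
  have hσ' : 0 ≤ σ' := by positivity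
  have hL1 : 1 ≤ P.L := P.L_pos
  -- box numerics: one block, `L` labels per direction, non-wrapping
  have hn : ∀ κ, hi κ ≤ lo κ + ((P.L - 1 : ℕ) : ℤ) := fun κ => by
    simp only [hhi, hlo]; push_cast [Nat.cast_sub hL1]; linarith
  have hnN : P.L - 1 < P.sitesPerDir m := by omega
  have hN' : ∀ κ, hi κ + 1 - lo κ < P.sitesPerDir m := fun κ => by
    simp only [hhi, hlo]
    have : (P.L : ℤ) < (P.sitesPerDir m : ℤ) := by exact_mod_cast hN
    linarith
  -- the bonds with both ends in `B(y)` are box bonds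
  have hbox : ∀ b' : PBond P m, blockOf b'.src = y → blockOf b'.tgt = y → b' ∈ boxBonds lo hi := by
    intro b' h1 h2
    have hs : b'.src ∈ (castSite '' Set.Icc lo hi : Set (Site P m)) := by
      have := mem_blowDown_of_blockOf_mem_box hm (⟨t, ⟨le_rfl, le_rfl⟩, h1.symm⟩ : blockOf b'.src ∈ (castSite '' Set.Icc t t : Set (Site P (m + 1))))
      simpa [hlo, hhi] using this
    have ht' : b'.tgt ∈ (castSite '' Set.Icc lo hi : Set (Site P m)) := by
      have := mem_blowDown_of_blockOf_mem_box hm (⟨t, ⟨le_rfl, le_rfl⟩, h2.symm⟩ : blockOf b'.tgt ∈ (castSite '' Set.Icc t t : Set (Site P (m + 1))))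
      simpa [hlo, hhi] using this
    exact mem_boxBonds_of_ends_mem_box hN' hs ht'
  -- every bond of `B(y)` of `W^g` is `τ`-close to `1`
  have hWg : ∀ b' : PBond P m, blockOf b'.src = y → blockOf b'.tgt = y → dist1 (gaugeAct g W b') ≤ τ := by
    intro b' h1 h2
    have hconj : gaugeAct g W b' = (Gy (emb y))⁻¹ * gaugeAct Gy W b' * ((Gy (emb y))⁻¹)⁻¹ := by
      show (Gy (emb y))⁻¹ * Gy b'.src * W b' * ((Gy (emb y))⁻¹ * Gy b'.tgt)⁻¹ = (Gy (emb y))⁻¹ * (Gy b'.src * W b' * (Gy b'.tgt)⁻¹) * ((Gy (emb y))⁻¹)⁻¹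
      group
    rw [hconj, GaugeGroup.dist1_conj]
    exact dist1_gaugeAct_axialGauge_le_of_mem_boxBonds W subset_rfl hplaq ha hn hnN (hbox b' h1 h2)
  have hg1 : g (emb y) = 1 := by show (Gy (emb y))⁻¹ * Gy (emb y) = 1; exact inv_mul_cancel _
  -- the centre stairs of `W^g` are within `σ′ = d⌊(L−1)∕2⌋·τ`
  have hstair : ∀ (r : Fin P.d → Fin P.L) (k : Fin ((Nat.factorial P.d - 1) + 1)),
      ‖((stairFamily (gaugeAct g W) y r k : SU N) : Matrix (Fin N) (Fin N) ℂ) - 1‖ ≤ σ' := by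
    intro r k
    rw [← dist1_SU_eq]
    show dist1 (holT (gaugeAct g W) (emb y) (stairWord (permEnum P k) (off r))) ≤ σ'
    rw [holT_eq_holAt]
    have hsteps : ∀ st ∈ walk (emb y) (stairWord (permEnum P k) (off r)), dist1 (gaugeAct g W st.bond) ≤ τ := fun st hst =>
      hWg st.bond (T4Continuum.blockOf_ends_of_mem_stairWalk hm y r _ st hst).1 (T4Continuum.blockOf_ends_of_mem_stairWalk hm y r _ st hst).2
    refine (dist1_holAt_le_length_mul _ _ hsteps).trans ?_
    have hlen : ((walk (emb y) (stairWord (permEnum P k) (off r))).length : ℝ) ≤ ((P.d * ((P.L - 1) / 2) : ℕ) : ℝ) := by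
      rw [BlockAveragingEMLLinearised.length_walk]
      exact_mod_cast LatticeWordStokes.length_stairWord_le _ (off r) ((P.L - 1) / 2) fun ν => by
        have h := off_bounds r ν
        omega
    exact mul_le_mul_of_nonneg_right hlen hτ
  -- `g(x)⁻¹ = M({(W^g)(Γ^σ_{y,x})}_σ)` at every block site off the centre, hence `dist1 (g x) ≤ 7σ′`
  have hgx : ∀ x : Site P m, blockOf x = y → dist1 (g x) ≤ 7 * σ' := by
    intro x hx
    by_cases hxc : x = emb y
    · rw [hxc, hg1, GaugeGroup.dist1_one]; positivity
    · set r : Fin P.d → Fin P.L := Site.blockEquiv hm y ⟨x, hx⟩ with hr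
      have hxr : Site.blockSite y r = x := congrArg Subtype.val ((Site.blockEquiv hm y).symm_apply_apply ⟨x, hx⟩)
      have hfam_g : FamilySmall (federbushSU (n := Fin N)).δ (stairFamily (gaugeAct g W) y r) :=
        familySmall_of_norm_le _ (hstair r) (by rw [hσ'def]; exact hguard)
      have hfam : FamilySmall (federbushSU (n := Fin N)).δ (stairFamily W y r) := (familySmall_stairFamily_gaugeAct_iff _ g W y r).1 hfam_g
      have hax : (symContourData (federbushSU (n := Fin N))).holTo W y x = 1 := hW y x hx hxc
      rw [← hxr, symContourData_holTo_of_small _ hm W y r hfam] at hax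
      -- `stairFamily W = 1 · stairFamily (W^g) · g(x)` memberwise
      have hrel : stairFamily W y r = fun i => 1 * stairFamily (gaugeAct g W) y r i * g (Site.blockSite y r) := by
        funext i
        have h := congrFun (stairFamily_gaugeAct g W y r) i
        rw [hg1] at h
        rw [h]; group
      rw [hrel, (federbushSU (n := Fin N)).equivariant _ hfam_g 1 (g (Site.blockSite y r)), one_mul] at hax
      -- `M · g(x) = 1 ⇒ g(x) = M⁻¹`
      have hgM : g (Site.blockSite y r) = ((federbushSU (n := Fin N)).M (stairFamily (gaugeAct g W) y r))⁻¹ := eq_inv_of_mul_eq_one_right hax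
      rw [hxr] at hgM
      rw [hgM, GaugeGroup.dist1_inv, dist1_SU_eq]
      exact norm_coe_fedM_sub_one_le _ (hstair r) (by rw [hσ'def]; exact hguard)
  -- `W b = g(b₋)⁻¹ (W^g b) g(b₊)`
  have hWb : W b = (g b.src)⁻¹ * gaugeAct g W b * g b.tgt := by
    simp only [gaugeAct, GaugeField.gaugeAct]; group
  rw [hWb]
  calc dist1 ((g b.src)⁻¹ * gaugeAct g W b * g b.tgt)
      ≤ dist1 ((g b.src)⁻¹ * gaugeAct g W b) + dist1 (g b.tgt) := GaugeGroup.dist1_mul_le _ _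
    _ ≤ dist1 ((g b.src)⁻¹) + dist1 (gaugeAct g W b) + dist1 (g b.tgt) := by
        linarith [GaugeGroup.dist1_mul_le (g b.src)⁻¹ (gaugeAct g W b)]
    _ ≤ 7 * σ' + τ + 7 * σ' := by
        rw [GaugeGroup.dist1_inv]
        exact add_le_add (add_le_add (hgx _ hsrc) (hWg b hsrc htgt)) (hgx _ htgt)
    _ = ((14 * (P.d * ((P.L - 1) / 2)) + 1 : ℕ) : ℝ) * τ := by rw [hσ'def]; push_cast; ring

end Sym

/-! ## §2  At the record: within-block and crossing bonds of a dent pair at a representative with the averaged-contour tower -/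

section Representative

variable {F : T4Family} {N : ℕ} [NeZero N]

/-- ★ **WITHIN-BLOCK BONDS OF A `symCd`-AXIAL LEVEL** (`F`-level reading of §1): `dist1 (M^m U′ b) ≤ τ_sym(a) := (14d⌊(L−1)∕2⌋ + 1)·((d−1)(L−1)·a)` for both ends in `B(castSite t)`, from the
plaquettes of `M^m U′` based in the block's box. [cite: Balaban1985RegularSpaces, (1.15) p.78, pp.79–80; Balaban1987RG1, (0.11) p.253] -/
theorem dist1_iter_within_le_of_box_sym {K m : ℕ} (hm : m + 1 ≤ (F.P K).m + (F.P K).K) (U' : GaugeField (F.P K) 0 (SU N))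
    (htower : AxialGauge (symCd F N K m) (Averaging.iter (avOfRecord F N K) m U'))
    {a : ℝ} (ha : 0 ≤ a) (hN : (F.P K).L < (F.P K).sitesPerDir m)
    (hguard : 2 * ((((F.P K).d * (((F.P K).L - 1) / 2) : ℕ) : ℝ) * (((((F.P K).d - 1 : ℕ) : ℝ) * (((F.P K).L - 1 : ℕ) : ℝ)) * a)) < (federbushSU (n := Fin N)).δ)
    (t : Pt (F.P K).d)
    (hW : PlaqSmallOn (boxPlaqs (fun i => ((F.P K).L : ℤ) * t i) (fun i => ((F.P K).L : ℤ) * t i + (((F.P K).L : ℤ) - 1))) a (Averaging.iter (avOfRecord F N K) m U'))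
    (b : PBond (F.P K) m) (hsrc : blockOf b.src = (castSite t : Site (F.P K) (m + 1))) (htgt : blockOf b.tgt = (castSite t : Site (F.P K) (m + 1))) :
    dist1 (Averaging.iter (avOfRecord F N K) m U' b) ≤
      ((14 * ((F.P K).d * (((F.P K).L - 1) / 2)) + 1 : ℕ) : ℝ) * (((((F.P K).d - 1 : ℕ) : ℝ) * (((F.P K).L - 1 : ℕ) : ℝ)) * a) :=
  dist1_le_of_axialGauge_sym_box hm _ htower ha hN t hW hguard b hsrc htgt

/-- ★★ **THE CROSSING BONDS OF A DENT PAIR AT A `symCd`-AXIAL REPRESENTATIVE** (print's (160) second case; 71 §2's `dist1_iter_crossing_le_of_twoBlocks` twin): MODULE 70's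
convention-free two-block Lemma 1 with §2's within-block letter on BOTH blocks — for a crossing bond `b` from `B(castSite t)` into `B(castSite (t + e_μ))`:
`dist1 (M^m U′ b) ≤ α + 7t₂ + (d+1)(L−1)·τ_sym(a)` from the level-`m` plaquettes of `M^m U′` based in the TWO blocks (`< a`, `0 < a`) and the parent's letter
`dist1 (M^{m+1}U′ ⟨castSite t, μ⟩) ≤ α`.  Guards: `2L < N_m`, MODULE 68's `δ_N`-guard, the stair guard.
[cite: Balaban1985Variational, (160) p.303; Balaban1985RegularSpaces, Lemma 1 (1.25) p.79, (1.15) p.78; Balaban1987RG1, (0.11) p.253] -/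
theorem dist1_iter_crossing_le_of_twoBlocks_sym {K m : ℕ} (hm : m + 1 ≤ (F.P K).m + (F.P K).K) (U' : GaugeField (F.P K) 0 (SU N))
    (htower : AxialGauge (symCd F N K m) (Averaging.iter (avOfRecord F N K) m U'))
    {a α : ℝ} (ha : 0 < a) (hN : 2 * (F.P K).L < (F.P K).sitesPerDir m)
    (ht : (((((F.P K).d + 2) * (F.P K).L : ℕ) : ℝ) ^ 2 / 4) * ((4 * (((((F.P K).d - 1 : ℕ) : ℝ)) * ((2 * (F.P K).L - 1 : ℕ) : ℝ)) + 1) * a) < deltaSU (Fin N))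
    (hguard : 2 * ((((F.P K).d * (((F.P K).L - 1) / 2) : ℕ) : ℝ) * (((((F.P K).d - 1 : ℕ) : ℝ) * (((F.P K).L - 1 : ℕ) : ℝ)) * a)) < (federbushSU (n := Fin N)).δ)
    (t : Pt (F.P K).d) (μ : Fin (F.P K).d)
    (hW : PlaqSmallOn (boxPlaqs (fun i => ((F.P K).L : ℤ) * t i) (fun i => ((F.P K).L : ℤ) * (t + e μ) i + (((F.P K).L : ℤ) - 1))) a
      (Averaging.iter (avOfRecord F N K) m U'))
    (hα : dist1 (Averaging.iter (avOfRecord F N K) (m + 1) U' ⟨castSite t, μ⟩) ≤ α)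
    (b : PBond (F.P K) m) (hsrc : blockOf b.src = (castSite t : Site (F.P K) (m + 1))) (hdir : b.dir = μ)
    (htgt : blockOf b.tgt = (castSite (t + e μ) : Site (F.P K) (m + 1))) :
    dist1 (Averaging.iter (avOfRecord F N K) m U' b) ≤
      α + 7 * ((((((F.P K).d + 2) * (F.P K).L : ℕ) : ℝ) ^ 2 / 4) * ((4 * (((((F.P K).d - 1 : ℕ) : ℝ)) * ((2 * (F.P K).L - 1 : ℕ) : ℝ)) + 1) * a)) +
        ((((F.P K).d + 1) * ((F.P K).L - 1) : ℕ) : ℝ) *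
          (((14 * ((F.P K).d * (((F.P K).L - 1) / 2)) + 1 : ℕ) : ℝ) * (((((F.P K).d - 1 : ℕ) : ℝ) * (((F.P K).L - 1 : ℕ) : ℝ)) * a)) := by
  -- adapted from MODULE 71 §2 `dist1_iter_crossing_le_of_twoBlocks` (radial ↦ averaged contour datum)
  have hL0 : (0 : ℤ) ≤ (F.P K).L := by positivity
  have hL1 : (1 : ℤ) ≤ (F.P K).L := by exact_mod_cast (F.P K).L_pos
  have hN1 : (F.P K).L < (F.P K).sitesPerDir m := by omega
  have he0 : ∀ κ, (0 : ℤ) ≤ e μ κ := fun κ => by rw [e_apply]; split_ifs <;> norm_num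
  -- the within-block letter on both blocks (§1; each block's box lies in the two-block box)
  have hsub₁ : (boxPlaqs (fun i => ((F.P K).L : ℤ) * t i) (fun i => ((F.P K).L : ℤ) * t i + (((F.P K).L : ℤ) - 1)) : Set (Plaq (F.P K) m)) ⊆
      boxPlaqs (fun i => ((F.P K).L : ℤ) * t i) (fun i => ((F.P K).L : ℤ) * (t + e μ) i + (((F.P K).L : ℤ) - 1)) :=
    boxPlaqs_mono le_rfl (fun i => by simp only [Pi.add_apply]; nlinarith [he0 i])
  have hsub₂ : (boxPlaqs (fun i => ((F.P K).L : ℤ) * (t + e μ) i) (fun i => ((F.P K).L : ℤ) * (t + e μ) i + (((F.P K).L : ℤ) - 1)) : Set (Plaq (F.P K) m)) ⊆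
      boxPlaqs (fun i => ((F.P K).L : ℤ) * t i) (fun i => ((F.P K).L : ℤ) * (t + e μ) i + (((F.P K).L : ℤ) - 1)) :=
    boxPlaqs_mono (fun i => by simp only [Pi.add_apply]; nlinarith [he0 i]) le_rfl
  have hτ₁ := fun b' h1 h2 => dist1_iter_within_le_of_box_sym hm U' htower ha.le hN1 hguard t (fun q hq => hW q (hsub₁ hq)) b' h1 h2
  have hτ₂ := fun b' h1 h2 => dist1_iter_within_le_of_box_sym hm U' htower ha.le hN1 hguard (t + e μ) (fun q hq => hW q (hsub₂ hq)) b' h1 h2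
  have hshift : ((castSite t : Site (F.P K) (m + 1)).shift μ) = castSite (t + e μ) := (castSite_add_e t μ).symm
  have hint : ∀ b' : PBond (F.P K) m, blockOf b'.src = blockOf b'.tgt →
      (blockOf b'.src = (castSite t : Site (F.P K) (m + 1)) ∨ blockOf b'.src = (castSite t : Site (F.P K) (m + 1)).shift μ) →
      dist1 (Averaging.iter (avOfRecord F N K) m U' b') ≤
        (((14 * ((F.P K).d * (((F.P K).L - 1) / 2)) + 1 : ℕ) : ℝ) * (((((F.P K).d - 1 : ℕ) : ℝ) * (((F.P K).L - 1 : ℕ) : ℝ)) * a)) := by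
    intro b' hst hb'
    rcases hb' with h | h
    · exact hτ₁ b' h (hst ▸ h)
    · rw [hshift] at h
      exact hτ₂ b' h (hst ▸ h)
  -- the crossing bond sits on the far face of `B(castSite t)` in the direction `μ`
  have hne : blockOf b.tgt ≠ blockOf b.src := by
    rw [htgt, hsrc, ← hshift]
    intro h
    have h1 := congrFun h μ
    rw [Site.shift_apply, if_pos rfl] at h1
    have h2 : (1 : ZMod ((F.P K).sitesPerDir (m + 1))) = 0 := by linear_combination h1
    exact one_ne_zero h2
  obtain ⟨-, r, hr, hbr⟩ := exists_coarse_of_crossing hm b hne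
  rw [hdir] at hr
  have hτ0 : 0 ≤ (((14 * ((F.P K).d * (((F.P K).L - 1) / 2)) + 1 : ℕ) : ℝ) * (((((F.P K).d - 1 : ℕ) : ℝ) * (((F.P K).L - 1 : ℕ) : ℝ)) * a)) := by
    have := ha.le; positivity
  have hmain := dist1_crossingBond_iter_le_of_succ_twoBlocks (F := F) (N := N) hm U' ha hτ0 hN ht t μ hW hα hint r hr 1 1
  have hb : b = ⟨Site.blockSite (castSite t : Site (F.P K) (m + 1)) r, μ⟩ := by
    rw [hbr, hsrc, hdir]
  rw [hb]
  exact hmain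

end Representative

end Summit.QuantumFields.YangMills.BalabanUVNodes.N07SymGaugeWithinBlock

end
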